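import Summits.QuantumFields.YangMills.Theorems.FemtoCurvatureSkewness.Negative.ZeroCoupling
import Summits.QuantumFields.YangMills.Theorems.LangevinControlUVFemtoCurvatureSkewnessPerpPropagatorPos
import Summits.QuantumFields.YangMills.Theorems.LangevinControlUVFemtoCurvatureSkewnessPressureCGF
import Summits.QuantumFields.YangMills.Theorems.LangevinControlUVFemtoCurvatureSkewnessTreeRatioFloor

/-!
# Route `LangevinControlUV`, crux `FemtoCurvatureSkewness` (stmt-QuantumFields-9365): vocabulary of line `coupling-cubic-response`

Route-posited objects (D-0016 `<Route><Crux>Defs` file) of the skeleton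
`Cruxes/FemtoCurvatureSkewness/Lines/coupling_cubic_response.lean` (planner
`planner-cruxplan-stmt-QuantumFields-9365-coupling-cubic-respo-0`, lead `prover-line-stmt-QuantumFields-9365-c1-0`), VERBATIM
the skeleton's declarations in the SAME namespace `Summit.QuantumFields.YangMills.Cruxes.FemtoCurvatureSkewness.CouplingCubicResponse`,
so that the stub signatures registered on the crux item (`Stub.MarkedCouplingDominance : MarkedCouplingDominance`,
`Stub.InfraredFloor : InfraredFloor`, and the written-out `Stub.PressureCGF`, `Stub.TreeRatioFloor`, `Stub.GlobalSkewSign`) are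
unchanged and the stubs taken BY NAME become landable from `Theorems/`.  NOTHING here is asserted: every `def … : Prop` is
a line statement that some registered stub proves or consumes (two are already theorems of the tree:
`Theorems.FemtoCurvatureSkewness.PressureCGF` p97990 and `.TreeRatioFloor` p104535 prove `PressureCGF` / `TreeRatioFloor`
verbatim), none is a literature fact, none restates the crux as a claim (`crux_iff` in the companion file
`LangevinControlUVFemtoCurvatureSkewnessReduction.lean` is `Iff.rfl` over the landed `TwoPointPackage` / `SkewnessPackage`).

* §1 abbreviations over the landed crux vocabulary (`Theorems/FemtoCurvatureSkewness/Negative/ZeroCoupling.lean`: `plaq`, `wE`,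
  `wCov`, `kappa3`, `TwoPointPackage`, `SkewnessPackage`): the axis covariance `covAxis`, the mixed coupling-derivatives
  `D3`, `D2` of the torus pressure with three / two marked plaquette couplings, the explicit zero-mode-free transverse torus
  propagator at the axis / diagonal displacement `torusPropAxis`, `torusPropDiag` (the `PerpPropagatorPos` sums), honest unit
  maps `IsHonestUnitMap`, and the line's intermediate predicates `PressureDominance` (one-loop dominance of `D3`, `D2` with one
  common coupling factor and a FIXED relative error), `SignedRigidity` (`c₃·Cov·√Cov ≤ κ₃` on femto boxes), `SkewnessFloor`
  (the a-free floor `n⁸Cov ≥ ε ⇒ n¹²|κ₃| ≥ δ(ε)`).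
* §4 (theorems) the UV glue over the two LANDED stubs: `pressureCGF_holds`, `treeRatioFloor_holds`, `torusPropAxis_pos`,
  `torusPropDiag_pos`, `signedRigidity_of_dominance` (`PressureDominance r a → SignedRigidity r a`, registered sub-goal),
  `kappa3_pos_of_dominance`.
* §2 the five stub statements: `MarkedCouplingDominance` (E, the UV ENGINE), `PressureCGF` (I, landed), `TreeRatioFloor`
  (T, landed), `GlobalSkewSign` (S, infrared sign), `InfraredFloor` (R, infrared floor); and the ∃-bundled (R1) form of the
  crux `SkewnessForPackageMap` (Memo-forall-a-exposure R1; what the route's assembly consumes).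

Refs: line card `Cruxes/FemtoCurvatureSkewness/Lines/coupling-cubic-response.md`; idea card
`Cruxes/FemtoCurvatureSkewness/Ideas/coupling-cubic-response.md`; `Cruxes/FemtoCurvatureSkewness/Disproof.lean` (v6).
-/

set_option autoImplicit false

noncomputable section

namespace Summit.QuantumFields.YangMills.Cruxes.FemtoCurvatureSkewness.CouplingCubicResponse

open MeasureTheory Filter Topology
open scoped BigOperators
open Literature.MathematicalPhysics.QuantumFieldTheory
open Summit.QuantumFields.YangMills.Theorems.ContinuumLimitOnTrajectory.Negative (piHaar)
open Summit.QuantumFields.YangMills.Theorems.FemtoCurvatureSkewness.Negative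
  (plaq wE wCov kappa3 TwoPointPackage SkewnessPackage)

/-! ## §1 Vocabulary of the line (abbreviations over the landed crux vocabulary) -/

section Vocabulary

variable {G : Type} [Group G] [TopologicalSpace G] [IsTopologicalGroup G] [CompactSpace G]
  [MeasurableSpace G] [BorelSpace G]

/-- The axis covariance `Cov_{L,β}(P_0^{01}, P_{ne₂}^{01})` of the crux's two-point package. -/
abbrev covAxis (r : LatticeRep G) (L : ℕ) [NeZero L] (β : ℝ) (n : ℕ) : ℝ :=
  wCov r L β (plaq r L 0 0 1) (plaq r L (Pi.single (2 : Fin 4) ((n : ℕ) : ZMod L)) 0 1)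

/-- `D₃ = ∂³_{t₀t₂t₃} log Z_L(β;t)|₀` — third mixed coupling-derivative of the torus pressure, where
`Z_L(β;t) = ∫ exp(−βS − t₀P₀ − t₂P_{ne₂} − t₃P_{ne₃}) dHaar^{⊗E}` is the source-extended partition function (Wilson weight with
the couplings of the three marked `(0,1)`-plaquettes at `0`, `ne₂`, `ne₃` shifted by real sources; card A1's `Zsrc`). -/
def D3 (r : LatticeRep G) (L : ℕ) [NeZero L] (β : ℝ) (n : ℕ) : ℝ :=
  deriv (fun t₀ : ℝ => deriv (fun t₂ : ℝ => deriv (fun t₃ : ℝ =>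
    Real.log (∫ U, Real.exp (-β * wilsonAction (d := 4) (L := L) r.ρ U - t₀ * plaq r L 0 0 1 U
      - t₂ * plaq r L (Pi.single (2 : Fin 4) ((n : ℕ) : ZMod L)) 0 1 U
      - t₃ * plaq r L (Pi.single (3 : Fin 4) ((n : ℕ) : ZMod L)) 0 1 U) ∂piHaar L)) 0) 0) 0

/-- `D₂ = ∂²_{t₀t₂} log Z_L(β;t₀,t₂,0)|₀` — second mixed coupling-derivative of the torus pressure. -/
def D2 (r : LatticeRep G) (L : ℕ) [NeZero L] (β : ℝ) (n : ℕ) : ℝ :=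
  deriv (fun t₀ : ℝ => deriv (fun t₂ : ℝ =>
    Real.log (∫ U, Real.exp (-β * wilsonAction (d := 4) (L := L) r.ρ U - t₀ * plaq r L 0 0 1 U
      - t₂ * plaq r L (Pi.single (2 : Fin 4) ((n : ℕ) : ZMod L)) 0 1 U) ∂piHaar L)) 0) 0

end Vocabulary

/-- The (un-normalised: `L⁴·`) zero-mode-free transverse torus propagator of the `(0,1)`-plaquette field at the AXIS
displacement `n e₂`: `∑_{k ≠ 0} (k̂₀²+k̂₁²)/k̂² · cos(2π k₂ n/L)` — verbatim the first sum of the landed `PerpPropagatorPos`.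
(The normalisation `L⁻⁴` is absorbed in the engine's coupling factor `λ`.) -/
def torusPropAxis (L n : ℕ) [NeZero L] : ℝ :=
  ∑ k : Fin 4 → ZMod L,
    (if k = 0 then 0 else ((2 - 2 * Real.cos (2 * Real.pi * ((k 0).val : ℝ) / L)) + (2 - 2 * Real.cos (2 * Real.pi * ((k 1).val : ℝ) / L))) /
      ((2 - 2 * Real.cos (2 * Real.pi * ((k 0).val : ℝ) / L)) + (2 - 2 * Real.cos (2 * Real.pi * ((k 1).val : ℝ) / L)) +
        (2 - 2 * Real.cos (2 * Real.pi * ((k 2).val : ℝ) / L)) + (2 - 2 * Real.cos (2 * Real.pi * ((k 3).val : ℝ) / L)))) *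
      Real.cos (2 * Real.pi * ((k 2).val : ℝ) * n / L)

/-- The same propagator at the DIAGONAL displacement `n(e₃ − e₂)` (the hypotenuse of the crux's triangle) — verbatim the second
sum of `PerpPropagatorPos`. -/
def torusPropDiag (L n : ℕ) [NeZero L] : ℝ :=
  ∑ k : Fin 4 → ZMod L,
    (if k = 0 then 0 else ((2 - 2 * Real.cos (2 * Real.pi * ((k 0).val : ℝ) / L)) + (2 - 2 * Real.cos (2 * Real.pi * ((k 1).val : ℝ) / L))) /
      ((2 - 2 * Real.cos (2 * Real.pi * ((k 0).val : ℝ) / L)) + (2 - 2 * Real.cos (2 * Real.pi * ((k 1).val : ℝ) / L)) +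
        (2 - 2 * Real.cos (2 * Real.pi * ((k 2).val : ℝ) / L)) + (2 - 2 * Real.cos (2 * Real.pi * ((k 3).val : ℝ) / L)))) *
      Real.cos (2 * Real.pi * (((k 3).val : ℝ) - ((k 2).val : ℝ)) * n / L)

/-- An HONEST unit map: positive, tending to `0`, continuous and strictly decreasing (the flow's own lattice-spacing map is
of this kind; wild choice-constructed maps — `Negative/WildUnitMap.lean` — are not). -/
def IsHonestUnitMap (a : ℝ → ℝ) : Prop :=
  (∀ β, 0 < a β) ∧ Tendsto a atTop (𝓝 0) ∧ Continuous a ∧ StrictAnti a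

section Physics

variable {G : Type} [Group G] [TopologicalSpace G] [IsTopologicalGroup G] [CompactSpace G]
  [MeasurableSpace G] [BorelSpace G]

/-- **One-loop dominance of the marked-coupling pressure derivatives for the unit map `a`** (C⁺ of the card): in `a`'s femto
regime (`β ≥ β₁`, `L·a(β) ≤ ℓ₁`), for `1 ≤ n ≤ L/8`, there is a coupling factor `λ > 0` with
`−D₃ = 8dλ³·G_a²G_d·(1 ± θ)` and `D₂ = 2dλ²·G_a²·(1 ± θ)` (`G_a = torusPropAxis`, `G_d = torusPropDiag`, `d > 0` the colour
multiplicity, `θ < 1` FIXED). -/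
def PressureDominance (r : LatticeRep G) (a : ℝ → ℝ) : Prop :=
  ∃ (β₁ ℓ₁ θ d : ℝ), 0 < ℓ₁ ∧ 0 ≤ θ ∧ θ < 1 ∧ 0 < d ∧
    ∀ (L : ℕ) [NeZero L] (β : ℝ), β₁ ≤ β → (L : ℝ) * a β ≤ ℓ₁ →
      ∀ n : ℕ, 1 ≤ n → 8 * n ≤ L → ∃ lam : ℝ, 0 < lam ∧
        |(-D3 r L β n) - 8 * d * lam ^ 3 * (torusPropAxis L n ^ 2 * torusPropDiag L n)| ≤
            θ * (8 * d * lam ^ 3 * (torusPropAxis L n ^ 2 * torusPropDiag L n)) ∧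
        |D2 r L β n - 2 * d * lam ^ 2 * torusPropAxis L n ^ 2| ≤ θ * (2 * d * lam ^ 2 * torusPropAxis L n ^ 2)

/-- **Signed rigidity for the unit map `a`**: in `a`'s femto regime the axis covariance is positive and
`c₃ · Cov · √Cov ≤ κ₃` (equivalently `c₃ (n⁸Cov)^{3/2} ≤ n¹²κ₃`): skewness dominated below, WITH SIGN, by covariance^{3/2}. -/
def SignedRigidity (r : LatticeRep G) (a : ℝ → ℝ) : Prop :=
  ∃ (β₁ ℓ₁ c₃ : ℝ), 0 < ℓ₁ ∧ 0 < c₃ ∧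
    ∀ (L : ℕ) [NeZero L] (β : ℝ), β₁ ≤ β → (L : ℝ) * a β ≤ ℓ₁ →
      ∀ n : ℕ, 1 ≤ n → 8 * n ≤ L →
        0 < covAxis r L β n ∧ c₃ * covAxis r L β n * Real.sqrt (covAxis r L β n) ≤ kappa3 r L β n

/-- **The a-free skewness FLOOR** of `(G, r)`: above a coupling `β_u`, on ALL tori `L ≥ 8n`, the normalised cumulant is bounded
below by a positive function of the normalised axis covariance alone: `n⁸Cov ≥ ε ⇒ n¹²|κ₃| ≥ δ(ε) > 0`.  (Modulo the covariance
uniformities of `Negative/WildPackage.lean` this is EQUIVALENT to the typed `∀ a` crux; `skewnessPackage_of_floor` in the companion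
`…Reduction.lean` is the easy direction, for every unit map.) -/
def SkewnessFloor (r : LatticeRep G) : Prop :=
  ∃ βu : ℝ, ∀ ε : ℝ, 0 < ε → ∃ δ : ℝ, 0 < δ ∧ ∀ (L : ℕ) [NeZero L] (β : ℝ) (n : ℕ),
    βu ≤ β → 1 ≤ n → 8 * n ≤ L → ε ≤ (n : ℝ) ^ 8 * covAxis r L β n → δ ≤ (n : ℝ) ^ 12 * |kappa3 r L β n|

end Physics

/-! ## §2 The five stub statements -/

/-- **Stub E `MarkedCouplingDominance` — the ENGINE (crux-sized; "the whole bet", triage r1-2), conditional form.**  For compact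
simple `G` and any `r`: IF some unit map carries the two-point package, THEN the flow's HONEST unit map `a⋆` carries the package
together with one-loop dominance of the marked-coupling pressure derivatives (`PressureDominance`) in its femto regime.  Content
for the prover: Bałaban-grade ultraviolet stability of Wilson's measure with bounded measurable plaquette-dependent couplings
`β_p ∈ β + D_{r₀}` (complex, `r₀ = π/(12N)`, the uniform polydisc of card A2), differentiated three times in three marked
couplings; the `t₀t₂t₃`-coefficient of the scale-`j_n` one-loop effective action `−½ log det(C⁻¹ + ΣtᵢQᵢ)` is the main term
(Jacobi, card A3), finer scales are `e^{−κ·2n/M^k}`, coarser ones (incl. the toron scale) a geometric tail `M^{−12(k−j_n)}` —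
all inside the FIXED relative error `θ`.  It does NOT assert the sibling crux 9363 (hypothesis `∃ a, TwoPointPackage r a`). -/
def MarkedCouplingDominance : Prop :=
  ∀ (G : Type) [Group G] [TopologicalSpace G] [IsTopologicalGroup G] [CompactSpace G]
    [MeasurableSpace G] [BorelSpace G], IsCompactSimpleLieGroup G →
    ∀ (r : LatticeRep G), (∃ a : ℝ → ℝ, TwoPointPackage r a) →
      ∃ a : ℝ → ℝ, IsHonestUnitMap a ∧ TwoPointPackage r a ∧ PressureDominance r a

/-- **Stub I `PressureCGF` — cumulant-generating-function identities (LANDED: `Theorems.FemtoCurvatureSkewness.PressureCGF`,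
p97990 — parametric differentiation under the integral sign on the compact configuration space, thrice; `Z > 0`).**  For every compact `G`, `r`, torus `L`, coupling `β` and
separation `n`: `∂³_{t₀t₂t₃} log Z_L(β;t)|₀ = −κ₃(P_0^{01},P_{ne₂}^{01},P_{ne₃}^{01})` and `∂²_{t₀t₂} log Z_L(β;t₀,t₂,0)|₀ =
Cov(P_0^{01},P_{ne₂}^{01})` (sign convention `Z(t) = ∫ e^{−βS − Σ tᵢPᵢ}`; card A1, triage r1-1 check T4). -/
def PressureCGF : Prop :=
  ∀ (G : Type) [Group G] [TopologicalSpace G] [IsTopologicalGroup G] [CompactSpace G]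
    [MeasurableSpace G] [BorelSpace G] (r : LatticeRep G) (L : ℕ) [NeZero L] (β : ℝ) (n : ℕ),
    deriv (fun t₀ : ℝ => deriv (fun t₂ : ℝ => deriv (fun t₃ : ℝ =>
      Real.log (∫ U, Real.exp (-β * wilsonAction (d := 4) (L := L) r.ρ U - t₀ * plaq r L 0 0 1 U
        - t₂ * plaq r L (Pi.single (2 : Fin 4) ((n : ℕ) : ZMod L)) 0 1 U
        - t₃ * plaq r L (Pi.single (3 : Fin 4) ((n : ℕ) : ZMod L)) 0 1 U) ∂piHaar L)) 0) 0) 0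
      = -kappa3 r L β n ∧
    deriv (fun t₀ : ℝ => deriv (fun t₂ : ℝ =>
      Real.log (∫ U, Real.exp (-β * wilsonAction (d := 4) (L := L) r.ρ U - t₀ * plaq r L 0 0 1 U
        - t₂ * plaq r L (Pi.single (2 : Fin 4) ((n : ℕ) : ZMod L)) 0 1 U) ∂piHaar L)) 0) 0
      = wCov r L β (plaq r L 0 0 1) (plaq r L (Pi.single (2 : Fin 4) ((n : ℕ) : ZMod L)) 0 1)

/-- **Stub T `TreeRatioFloor` — tree-level uniformity (LANDED: `Theorems.FemtoCurvatureSkewness.TreeRatioFloor`, p104535, and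
`.TreeRatioFloorLazyWalk`, p106093 — two independent lattice-analysis proofs).**  The zero-mode-free transverse
torus propagator of the `(0,1)`-plaquette field at the diagonal displacement `n(e₃−e₂)` dominates a FIXED positive multiple of
its value at the axis displacement `ne₂`, uniformly in `1 ≤ n ≤ L/8` and in `L`: `ρ₀ · G_L(ne₂) ≤ G_L(n(e₃−e₂))`.  (Continuum /
infinite volume: `G(x) = 1/(π²|x|⁴)` at transverse `x`, ratio `1/4`; `L = 8, n = 1`: `0.288` (TreeTriangle-r1-i1); the content is
the uniform control of lattice artefacts at `n ≤ 3` and of finite-size effects at `n ≍ L/8` — via the 2-d Yukawa slicing of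
`PerpPropagatorPos`, whose `m`-average must be bounded, not each slice.) -/
def TreeRatioFloor : Prop :=
  ∃ ρ₀ : ℝ, 0 < ρ₀ ∧ ∀ (L n : ℕ) [NeZero L], 1 ≤ n → 8 * n ≤ L →
    ρ₀ * (∑ k : Fin 4 → ZMod L,
      (if k = 0 then 0 else ((2 - 2 * Real.cos (2 * Real.pi * ((k 0).val : ℝ) / L)) + (2 - 2 * Real.cos (2 * Real.pi * ((k 1).val : ℝ) / L))) /
        ((2 - 2 * Real.cos (2 * Real.pi * ((k 0).val : ℝ) / L)) + (2 - 2 * Real.cos (2 * Real.pi * ((k 1).val : ℝ) / L)) +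
          (2 - 2 * Real.cos (2 * Real.pi * ((k 2).val : ℝ) / L)) + (2 - 2 * Real.cos (2 * Real.pi * ((k 3).val : ℝ) / L)))) *
        Real.cos (2 * Real.pi * ((k 2).val : ℝ) * n / L)) ≤
    ∑ k : Fin 4 → ZMod L,
      (if k = 0 then 0 else ((2 - 2 * Real.cos (2 * Real.pi * ((k 0).val : ℝ) / L)) + (2 - 2 * Real.cos (2 * Real.pi * ((k 1).val : ℝ) / L))) /
        ((2 - 2 * Real.cos (2 * Real.pi * ((k 0).val : ℝ) / L)) + (2 - 2 * Real.cos (2 * Real.pi * ((k 1).val : ℝ) / L)) +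
          (2 - 2 * Real.cos (2 * Real.pi * ((k 2).val : ℝ) / L)) + (2 - 2 * Real.cos (2 * Real.pi * ((k 3).val : ℝ) / L)))) *
        Real.cos (2 * Real.pi * (((k 3).val : ℝ) - ((k 2).val : ℝ)) * n / L)

/-- **Stub S `GlobalSkewSign` — infrared residual I: global sign persistence (open; the disprover's target).**  For compact simple
`G` and any `r` there is a coupling `β_u` above which the crux cumulant is POSITIVE on every torus `L ≥ 8n`, `n ≥ 1` — no relation
between `L`, `n` and `β`.  NECESSARY for the typed `∀ a` crux modulo the covariance uniformities (`FalseOfUniformZeros`: zeros of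
`κ₃` along `β_k → ∞` refute the crux; `not_globalSkewSign_of_uniformZeros` in `…Reduction.lean`: the same hypothesis refutes this stub).  UV sign
`+` (tree triangle, `PerpPropagatorPos`); strong-coupling sign `(G,r)`-dependent (Disproof finding 3: `−` for `SU(3)` fundamental,
so zeros `β*(L,n)` exist on every torus and the stub asserts `sup_{L,n} β*(L,n) < ∞`); MC: `+` for `SU(2)`, `8⁴`, `n = 1`,
`β_std ≥ 1.6` (j008977). -/
def GlobalSkewSign : Prop :=
  ∀ (G : Type) [Group G] [TopologicalSpace G] [IsTopologicalGroup G] [CompactSpace G]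
    [MeasurableSpace G] [BorelSpace G], IsCompactSimpleLieGroup G →
    ∀ (r : LatticeRep G), ∃ βu : ℝ, ∀ (L : ℕ) [NeZero L] (β : ℝ) (n : ℕ),
      βu ≤ β → 1 ≤ n → 8 * n ≤ L → 0 < kappa3 r L β n

/-- **Stub R `InfraredFloor` — infrared residual II: from femto rigidity and the global sign to the a-free floor (open).**  For
compact simple `G`, any `r` and any HONEST unit map `a` carrying the two-point package with signed rigidity in its femto boxes:
if the global sign holds, then the skewness floor holds — i.e. positivity is UNIFORM on `{n⁸Cov ≥ ε}` across all volumes and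
couplings above a threshold.  Content: decoupling (femto triangles in large boxes keep their femto bounds) and infrared
cutoff/volume regularity of the three-point function at physical sizes pinned by `n⁸Cov ≥ ε` (the `E0′ at and above the
confinement scale` leg of the route's `OSLegsFromFemtoAndGap`).  NECESSARY for the typed crux modulo the uniformities; NOT
needed for the ∃-bundled form (`skewnessForPackageMap_of` in `…Reduction.lean`). -/
def InfraredFloor : Prop :=
  ∀ (G : Type) [Group G] [TopologicalSpace G] [IsTopologicalGroup G] [CompactSpace G]
    [MeasurableSpace G] [BorelSpace G], IsCompactSimpleLieGroup G →
    ∀ (r : LatticeRep G) (a : ℝ → ℝ), IsHonestUnitMap a → TwoPointPackage r a → SignedRigidity r a →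
      (∃ βu : ℝ, ∀ (L : ℕ) [NeZero L] (β : ℝ) (n : ℕ), βu ≤ β → 1 ≤ n → 8 * n ≤ L → 0 < kappa3 r L β n) →
      SkewnessFloor r

/-! ## §3 The ∃-bundled (R1) form of the crux -/

/-- **The ∃-bundled (assembly-sufficient) form of the crux** (Memo-forall-a-exposure R1; what `closes` consumes). -/
def SkewnessForPackageMap : Prop :=
  ∀ (G : Type) [Group G] [TopologicalSpace G] [IsTopologicalGroup G] [CompactSpace G],
    IsCompactSimpleLieGroup G →
      letI : MeasurableSpace G := borel G
      haveI : BorelSpace G := ⟨rfl⟩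
      ∀ (r : LatticeRep G), (∃ a : ℝ → ℝ, TwoPointPackage r a) →
        ∃ a : ℝ → ℝ, TwoPointPackage r a ∧ SkewnessPackage r a


/-! ## §4 The line's UV glue over the two LANDED stubs (theorems; nothing posited)

`PressureCGF` and `TreeRatioFloor` are theorems of the tree (`Theorems.FemtoCurvatureSkewness.PressureCGF`, p97990;
`.TreeRatioFloor`, p104535), so the skeleton's glue `dominance ⇒ signed rigidity` holds with NO stub hypothesis: on the femto
boxes of any unit map carrying `PressureDominance`, the axis covariance is positive and `c₃·Cov·√Cov ≤ κ₃` (the common coupling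
factor `λ` cancels), in particular `κ₃ > 0` there (`kappa3_pos_of_dominance`).  Registered sub-goal `signedRigidity_of_dominance`. -/

/-- Stub I holds: the CGF identities are the landed theorem `Theorems.FemtoCurvatureSkewness.PressureCGF` (p97990). -/
theorem pressureCGF_holds : PressureCGF :=
  Summit.QuantumFields.YangMills.Theorems.FemtoCurvatureSkewness.PressureCGF

/-- Stub T holds: the tree ratio floor is the landed theorem `Theorems.FemtoCurvatureSkewness.TreeRatioFloor` (p104535). -/
theorem treeRatioFloor_holds : TreeRatioFloor :=
  Summit.QuantumFields.YangMills.Theorems.FemtoCurvatureSkewness.TreeRatioFloor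

/-- Tree level: the axis propagator is positive (landed `PerpPropagatorPos`, p90356). -/
theorem torusPropAxis_pos (L n : ℕ) [NeZero L] (hn : 1 ≤ n) (h8 : 8 * n ≤ L) : 0 < torusPropAxis L n :=
  (Summit.QuantumFields.YangMills.Theorems.FemtoCurvatureSkewness.PerpPropagatorPos L n hn h8).1

/-- Tree level: the diagonal propagator is positive (landed `PerpPropagatorPos`, p90356). -/
theorem torusPropDiag_pos (L n : ℕ) [NeZero L] (hn : 1 ≤ n) (h8 : 8 * n ≤ L) : 0 < torusPropDiag L n :=
  (Summit.QuantumFields.YangMills.Theorems.FemtoCurvatureSkewness.PerpPropagatorPos L n hn h8).2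

/-- **Dominance ⇒ signed rigidity** (elementary real algebra over the two landed stubs): with `κ₃ ≥ (1−θ)·8dλ³G_a²G_d`
(`PressureCGF` turns `−D₃`, `D₂` into `κ₃`, `Cov`), `G_d ≥ ρ₀G_a` (`TreeRatioFloor`) and `Cov ≤ (1+θ)·2dλ²G_a²`, the common
coupling factor `λ` CANCELS: `κ₃ ≥ c₃·Cov·√Cov` with `c₃ = (1−θ)·8dρ₀ / (κ√κ)`, `κ = (1+θ)·2d`; and `Cov > 0`. -/
theorem signedRigidity_of_dominance :
    ∀ {G : Type} [Group G] [TopologicalSpace G] [IsTopologicalGroup G] [CompactSpace G] [MeasurableSpace G]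
      [BorelSpace G] (r : LatticeRep G) (a : ℝ → ℝ), PressureDominance r a → SignedRigidity r a := by
  intro G _ _ _ _ _ _ r a hD
  obtain ⟨ρ₀, hρ₀, hρ⟩ := treeRatioFloor_holds
  obtain ⟨β₁, ℓ₁, θ, d, hℓ₁, hθ0, hθ1, hd, H⟩ := hD
  have h1θ : 0 < 1 - θ := by linarith
  have h1θ' : 0 < 1 + θ := by linarith
  set κ : ℝ := (1 + θ) * 2 * d with hκ
  have hκpos : 0 < κ := by rw [hκ]; exact mul_pos (mul_pos h1θ' two_pos) hd
  have hsκ : 0 < Real.sqrt κ := Real.sqrt_pos.2 hκpos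
  have hden : 0 < κ * Real.sqrt κ := mul_pos hκpos hsκ
  have hnum : 0 < (1 - θ) * 8 * d * ρ₀ := mul_pos (mul_pos (mul_pos h1θ (by norm_num)) hd) hρ₀
  have hκne : κ ≠ 0 := hκpos.ne'
  have hsκne : Real.sqrt κ ≠ 0 := hsκ.ne'
  refine ⟨β₁, ℓ₁, (1 - θ) * 8 * d * ρ₀ / (κ * Real.sqrt κ), hℓ₁, div_pos hnum hden, ?_⟩
  intro L _ β hβ hL n hn h8
  obtain ⟨lam, hlam, h3, h2⟩ := H L β hβ hL n hn h8
  obtain ⟨hI3, hI2⟩ := pressureCGF_holds G r L β n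
  have hA : 0 < torusPropAxis L n := torusPropAxis_pos L n hn h8
  have hDg : ρ₀ * torusPropAxis L n ≤ torusPropDiag L n := hρ L n hn h8
  -- pressure derivatives ARE the cumulants
  have e3 : -D3 r L β n = kappa3 r L β n := by
    show -(D3 r L β n) = kappa3 r L β n
    rw [show D3 r L β n = -kappa3 r L β n from hI3, neg_neg]
  have e2 : D2 r L β n = covAxis r L β n := hI2
  rw [e3] at h3
  rw [e2] at h2
  set Cv := covAxis r L β n with hCv
  set K := kappa3 r L β n with hK
  set Ga := torusPropAxis L n with hGa
  set Gd := torusPropDiag L n with hGd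
  -- one-sided consequences of the two-sided dominance
  have hKlow : (1 - θ) * (8 * d * lam ^ 3 * (Ga ^ 2 * Gd)) ≤ K := by
    have := (abs_sub_le_iff.1 h3).2
    linarith
  have hCup : Cv ≤ (1 + θ) * (2 * d * lam ^ 2 * Ga ^ 2) := by
    have := (abs_sub_le_iff.1 h2).1
    linarith
  have hClow : (1 - θ) * (2 * d * lam ^ 2 * Ga ^ 2) ≤ Cv := by
    have := (abs_sub_le_iff.1 h2).2
    linarith
  have hCpos : 0 < Cv :=
    lt_of_lt_of_le (mul_pos h1θ (mul_pos (mul_pos (mul_pos two_pos hd) (pow_pos hlam 2)) (pow_pos hA 2))) hClow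
  refine ⟨hCpos, ?_⟩
  have hA0 : 0 < lam * Ga := mul_pos hlam hA
  -- upper side: Cov · √Cov ≤ κ√κ · (λ G_a)³
  have hCup' : Cv ≤ κ * (lam * Ga) ^ 2 := by
    have : (1 + θ) * (2 * d * lam ^ 2 * Ga ^ 2) = κ * (lam * Ga) ^ 2 := by simp only [hκ]; ring
    linarith
  have hsq : Real.sqrt Cv ≤ Real.sqrt κ * (lam * Ga) := by
    calc Real.sqrt Cv ≤ Real.sqrt (κ * (lam * Ga) ^ 2) := Real.sqrt_le_sqrt hCup'
      _ = Real.sqrt κ * (lam * Ga) := by rw [Real.sqrt_mul hκpos.le, Real.sqrt_sq hA0.le]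
  have hprod : Cv * Real.sqrt Cv ≤ κ * (lam * Ga) ^ 2 * (Real.sqrt κ * (lam * Ga)) :=
    mul_le_mul hCup' hsq (Real.sqrt_nonneg _) (mul_nonneg hκpos.le (sq_nonneg _))
  -- lower side: κ₃ ≥ (1−θ)·8dρ₀·(λ G_a)³
  have hKlow' : (1 - θ) * 8 * d * ρ₀ * (lam * Ga) ^ 3 ≤ K := by
    have hstep : Ga ^ 2 * (ρ₀ * Ga) ≤ Ga ^ 2 * Gd := mul_le_mul_of_nonneg_left hDg (sq_nonneg _)
    have hstep' : 8 * d * lam ^ 3 * (Ga ^ 2 * (ρ₀ * Ga)) ≤ 8 * d * lam ^ 3 * (Ga ^ 2 * Gd) :=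
      mul_le_mul_of_nonneg_left hstep (mul_pos (mul_pos (by norm_num) hd) (pow_pos hlam 3)).le
    have hstep'' : (1 - θ) * (8 * d * lam ^ 3 * (Ga ^ 2 * (ρ₀ * Ga))) ≤ (1 - θ) * (8 * d * lam ^ 3 * (Ga ^ 2 * Gd)) :=
      mul_le_mul_of_nonneg_left hstep' h1θ.le
    have heq : (1 - θ) * 8 * d * ρ₀ * (lam * Ga) ^ 3 = (1 - θ) * (8 * d * lam ^ 3 * (Ga ^ 2 * (ρ₀ * Ga))) := by ring
    linarith
  -- combine
  have heq2 : κ * (lam * Ga) ^ 2 * (Real.sqrt κ * (lam * Ga)) = (κ * Real.sqrt κ) * (lam * Ga) ^ 3 := by ring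
  calc (1 - θ) * 8 * d * ρ₀ / (κ * Real.sqrt κ) * Cv * Real.sqrt Cv
      = (1 - θ) * 8 * d * ρ₀ / (κ * Real.sqrt κ) * (Cv * Real.sqrt Cv) := by ring
    _ ≤ (1 - θ) * 8 * d * ρ₀ / (κ * Real.sqrt κ) * ((κ * Real.sqrt κ) * (lam * Ga) ^ 3) := by
        rw [← heq2]
        exact mul_le_mul_of_nonneg_left hprod (div_pos hnum hden).le
    _ = (1 - θ) * 8 * d * ρ₀ * (lam * Ga) ^ 3 := by
        field_simp
    _ ≤ K := hKlow'

/-- **On the engine's own boxes the sign is `+`** (kernel): dominance forces `κ₃ > 0` and `Cov > 0` in the femto regime of `a⋆`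
— the UV end of `GlobalSkewSign` is a CONSEQUENCE of the engine, only its infrared extension is the residual. -/
theorem kappa3_pos_of_dominance {G : Type} [Group G] [TopologicalSpace G] [IsTopologicalGroup G] [CompactSpace G]
    [MeasurableSpace G] [BorelSpace G] (r : LatticeRep G) (a : ℝ → ℝ) (hD : PressureDominance r a) :
    ∃ (β₁ ℓ₁ : ℝ), 0 < ℓ₁ ∧ ∀ (L : ℕ) [NeZero L] (β : ℝ), β₁ ≤ β → (L : ℝ) * a β ≤ ℓ₁ →
      ∀ n : ℕ, 1 ≤ n → 8 * n ≤ L → 0 < covAxis r L β n ∧ 0 < kappa3 r L β n := by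
  obtain ⟨β₁, ℓ₁, c₃, hℓ₁, hc₃, h⟩ := signedRigidity_of_dominance r a hD
  refine ⟨β₁, ℓ₁, hℓ₁, fun L _ β hβ hL n hn h8 => ?_⟩
  obtain ⟨hC, hrig⟩ := h L β hβ hL n hn h8
  refine ⟨hC, lt_of_lt_of_le ?_ hrig⟩
  exact mul_pos (mul_pos hc₃ hC) (Real.sqrt_pos.2 hC)

end Summit.QuantumFields.YangMills.Cruxes.FemtoCurvatureSkewness.CouplingCubicResponse

end
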